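/-
Copyright (c) 2026 the pub-hodgecm-mathlib formalisation cell (harness21).  Prover seat hodgecm-mathlib-A-p19 (g29): road «S3-ram» (LEAD F0P3a-plan (g13); owner ∕ (α) keeper
F0P3a-p06 (g16); (Cnt2′) chair F0P3a-p07 (g15), plan 05:03:10Z (Z-Aeven)∕(P-Aeven), RULING (18)), the A-EVEN hyperbolic cells over a per-vertex top census; 2026-09-02.
-/
import Literature.NumberTheory.Rogawski1990.TypeTwoRamifiedHyperbolicRootRegionCountAEven            -- ★ p849413 (this seat): `ncard_rootRegion_hyperbolic_of_even_A_ram` (`#R = q + 1`); brings (h1) FILES 1–4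
import Literature.NumberTheory.Rogawski1990.DepthZeroKappaTransferTypeTwoRamifiedHyperbolicTotals       -- ★ p849287 (F0P3a-p08 (g20)): raw head `BlockLawHyp.hyperbolicTotal_zero_ram_of_region_census_odd`
import Literature.NumberTheory.Rogawski1990.DepthZeroKappaTransferTypeTwoRamifiedHyperbolicTotalsPm     -- ★ p849335 (F0P3a-p08 (g20)): `BlockLawHyp.hyperbolicTotal_pm_ram_of_region_census_odd`
import Literature.NumberTheory.Rogawski1990.DepthZeroKappaTransferTypeTwoRamifiedDepthEvenMin           -- ★ p849372 (chair PART 5): `typeTwo_two_le_n_of_even_ram` (`mA ≥ 1`)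
import HarnessLib

/-!
# The A-even hyperbolic cells of the (Cnt2′) block law over a per-vertex census of the top root vertices (Rogawski 1990 §4.9; Kottwitz 1986 §3; Labesse–Langlands 1979 §2)

Topic `NumberTheory/Rogawski1990`; namespaces `Literature.NumberTheory.Automorphic.UnitaryLatticeTree` (§0, generic bookkeeping) and
`Literature.NumberTheory.Rogawski1990.BlockLawHyp` (§1–§2, the CM place).  THEOREMS ONLY (no definition, no instance, no notation, no named fact, no `sorry`); kernel lane
`--supports stmt-HodgeConjecture-24833`.  Cell `pub/hodgecm-mathlib` (D-0151), crux H413 `HCCMStratifiedTransfer`; road «S3-ram» (Literature seeding, count-neutral); the (α)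
BLOCK-LAW skeleton (keeper F0P3a-p06 (g16), texts v2 `stub_Zhyp_zero_even_A` 587a8c74 ∕ `stub_Zhyp_pm_even_A` 41fe9341), chair F0P3a-p07 (g15) ASSEMBLY PLAN 05:03:10Z
(Z-Aeven)∕(P-Aeven) and RULING (18) (pen split: regime-B hyperbolic cells = F0P3a-p08 (g21); the A-even pair = this seat).

REGIME A-EVEN of the hyperbolic type-(2) literal `ι(ĝ_w, û_w)` (`N = 2n = m`, `n = mA + 1 ≥ 2`): after the (h1) centring `B₀ = k⁻¹(s·ĝ_w)k` (`s·û₀₀ = 1`, `k ∈ U(σ_w, Φ₂,w)`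
of block depth `d₀ = N − 1 = 2n − 1`, ★ `exists_centre_forall_v_rerootedCentred_sub_one_le_of_even_ram`) the root region `R` of `γ′ = ι(B₀, 1)` at level `ϖ^{d₀}` has `q + 1`
vertices (★ `ncard_rootRegion_hyperbolic_of_even_A_ram`), all TOP (A-p12 (g25) 05:07:10Z: `c̄ = 0`), and F0P3a-p08 (g20)'s ★ socket heads `hyperbolicTotal_{zero,pm}_ram_of_region_census_odd`
at ROOT DEPTH `d₀ = 2(mA − 1) + 3` turn the pooled grandchild atoms `NE NP NM` over `R` into the socket counts.  THIS FILE closes the two A-even cells MODULO THE PER-VERTEX TOP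
CENSUS — the one input still being cut (F0P3a-p05 (g18) 05:11:44Z «TOP VERTEX IS MINE»: `blockVertexCensus_top` over A-p12's ★ (K4a) `blockVertexCensus_shell` currency, values
`(#E, #P, #M)(vtx) = (0, q²·[Q vtx], q²·[¬Q vtx])` with `Q` the vertex class token, kind halves ★ p05 XII `two_mul_ncard_rootRegion_[not_]class_eq_of_top_of_even_depth_ramified`) —
stated here as HYPOTHESES in the raw heads' own token texts (`∀ vtx ∈ R, …`), so that the keeper's cells become one `obtain` (★ A-p19 even depth head for `k`, ★
`exists_units_mul_oneByOne_eq_one` for `s`) and one `exact`: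

* §0 `exists_residual_nonsquare_unit` (the raw heads' auxiliary `ε`: `|ε| = 1`, `|z² − ε| = 1` on `𝒪`, from ★ `FiniteField.exists_nonsquare` at odd residue characteristic),
  private plumbing `ncard_setOf_mem_and_eq_card_filter`, `sum_eq_card_filter_mul_add` (kind-keyed pooling of a two-valued summand);
* §1 **`BlockLawHyp.zhyp_zero_even_A_ram_of_topVertexCensus`** — class-blind census (`#E = 0`, `#P + #M = q²` per root vertex) ⟹ `#A = (q+1)·Σ_{i<mA} q^{2i}`
  (`= (q+1)(1 + q²·Σ_{i<mA−1} q^{2i})`: `sR.card = q + 1`, `NE = 0`, `NP + NM = (q+1)q²`);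
* §2 **`BlockLawHyp.zhyp_pm_even_A_ram_of_topVertexCensus`** — kind-keyed census + `2·#{vtx ∈ R ∣ Q vtx} = q + 1` ⟹ `#A₊ = #A₋ = (q+1)∕2 · q^{2mA}` (`NP = NM = (q+1)q²∕2`, so the
  pm head's residual-sign `if` is idle).
HONEST LABEL: HC_CM is proved only modulo the 2 remaining named inputs (hLiu418 24832, h413 24833) until rung 0 closes; nothing printed is asserted here (lattice bookkeeping
over ★ results at one place); «S3-ram» has no books consequence.

## References
* [Rogawski1990] J. D. Rogawski, *Automorphic Representations of Unitary Groups in Three Variables*, Ann. of Math. Stud. 123 (1990), §4.9 Prop. 4.9.1 (a) p. 55, Lemma 4.9.3 p. 56.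
* [Kottwitz1986] R. E. Kottwitz, *Base change for unit elements of Hecke algebras*, Compositio Math. 60 (1986), §3.
* [LabesseLanglands1979] J.-P. Labesse, R. P. Langlands, *L-indistinguishability for SL(2)*, Canad. J. Math. 31 (1979), §2 Lemma 2.1 p. 8.
* [BruhatTits1972] F. Bruhat, J. Tits, *Groupes réductifs sur un corps local I*, Publ. Math. IHÉS 41 (1972), §10.
-/

set_option autoImplicit false

noncomputable section

open scoped Valued WithZero Matrix MatrixGroups
open Polynomial NumberField IsDedekindDomain
open Literature.NumberTheory.Automorphic Literature.NumberTheory.Automorphic.HermitianLattice Literature.NumberTheory.Automorphic.UnitaryLatticeTree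
open Literature.NumberTheory.Automorphic.UnitaryGroup Literature.NumberTheory.GaloisRepresentations
open Literature.NumberTheory.Rogawski1990

namespace Literature.NumberTheory.Automorphic.UnitaryLatticeTree

/-! ## §0 Bookkeeping: a residual non-square unit; kind-keyed pooling -/

section Generic

variable {K : Type*} [Field K] [Valued K ℤᵐ⁰]

/-- **A RESIDUAL NON-SQUARE UNIT.**  If `|2| = 1` and the residue field is finite, there is `ε ∈ 𝒪^×` with `|z² − ε| = 1` for every `z ∈ 𝒪` (lift a non-square of `𝓀`,
★ `FiniteField.exists_nonsquare`) — the auxiliary `ε` of the junction heads. [cite: Kottwitz1986, §3] -/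
theorem exists_residual_nonsquare_unit [Finite 𝓀[K]] (h2 : Valued.v (2 : K) = 1) :
    ∃ ε : K, Valued.v ε = 1 ∧ ∀ z : K, Valued.v z ≤ 1 → Valued.v (z ^ 2 - ε) = 1 := by
  obtain ⟨e, he⟩ := FiniteField.exists_nonsquare (ringChar_residueField_ne_two h2)
  obtain ⟨εO, hεO⟩ := IsLocalRing.residue_surjective e
  have hunit : ∀ x : 𝒪[K], IsLocalRing.residue 𝒪[K] x ≠ 0 → Valued.v (x : K) = 1 := fun x hx =>
    le_antisymm x.2 (not_lt.1 fun hlt => hx ((residue_eq_zero_iff_v_lt_one x).2 hlt))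
  refine ⟨(εO : K), hunit εO ?_, fun z hz => ?_⟩
  · rw [hεO]; rintro rfl; exact he (IsSquare.zero)
  · set zO : 𝒪[K] := ⟨z, hz⟩ with hzO_def
    have hzO : Valued.v (((zO ^ 2 - εO : 𝒪[K])) : K) = 1 := by
      refine hunit _ fun h0 => he ?_
      rw [map_sub, map_pow, hεO, sub_eq_zero] at h0
      exact ⟨IsLocalRing.residue 𝒪[K] zO, by rw [← h0, sq]⟩
    have hcoe : (((zO ^ 2 - εO : 𝒪[K])) : K) = (zO : K) ^ 2 - (εO : K) := by push_cast; rfl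
    change Valued.v ((zO : K) ^ 2 - (εO : K)) = 1
    rwa [hcoe] at hzO

omit [Valued K ℤᵐ⁰] in
/-- `#{x ∣ x ∈ S ∧ Q x} = #(S.toFinset.filter Q)` for finite `S` (private plumbing). [folklore] -/
private theorem ncard_setOf_mem_and_eq_card_filter {α : Type*} {S : Set α} (hS : S.Finite) {Q : α → Prop} [DecidablePred Q] :
    {x | x ∈ S ∧ Q x}.ncard = (hS.toFinset.filter fun x => Q x).card := by
  rw [← Set.ncard_coe_finset, Finset.coe_filter]
  congr 1
  ext x
  simp only [Set.mem_setOf_eq, Set.Finite.mem_toFinset]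

omit [Valued K ℤᵐ⁰] in
/-- **KIND-KEYED POOLING OF A TWO-VALUED SUMMAND** (private plumbing): if `f = a` on the `Q`-members of `s` and `f = b` on the others, `Σ_s f = #(s ∣ Q)·a + #(s ∣ ¬Q)·b`. [folklore] -/
private theorem sum_eq_card_filter_mul_add {ι : Type*} (s : Finset ι) (Q : ι → Prop) [DecidablePred Q] {f : ι → ℕ} (a b : ℕ)
    (ha : ∀ x ∈ s, Q x → f x = a) (hb : ∀ x ∈ s, ¬ Q x → f x = b) :
    ∑ x ∈ s, f x = (s.filter fun x => Q x).card * a + (s.filter fun x => ¬ Q x).card * b := by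
  rw [← Finset.sum_filter_add_sum_filter_not s (fun x => Q x) f,
    Finset.sum_congr rfl fun x hx => ha x (Finset.mem_filter.1 hx).1 (Finset.mem_filter.1 hx).2,
    Finset.sum_congr rfl fun x hx => hb x (Finset.mem_filter.1 hx).1 (Finset.mem_filter.1 hx).2,
    Finset.sum_const, Finset.sum_const, smul_eq_mul, smul_eq_mul]

end Generic

end Literature.NumberTheory.Automorphic.UnitaryLatticeTree

/-! ## §1–§2 The CM dress: the A-even hyperbolic cells over a per-vertex top census -/

namespace Literature.NumberTheory.Rogawski1990.BlockLawHyp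

variable (L : Type) [Field L] [NumberField L] [IsCMField L] {v : HeightOneSpectrum (𝓞 ↥(maximalRealSubfield L))}
  (w : PlacesOver L v) (hw : IsCMField.complexConj L • w.1 = w.1)

set_option maxHeartbeats 3200000 in
-- budget only: statement-heavy lattice tokens (the ★ raw head's texts, per vertex; the head's own budget ×2 for the per-vertex hypotheses).
/-- **THE A-EVEN ROW-`0` CELL OVER A PER-VERTEX TOP CENSUS.**  Regime A-even of the hyperbolic literal (`N = 2n = m`, `n = mA + 1`): for the J0diff's binders, a centring
unit `s` (`s·û₀₀ = 1`), a conjugator `k ∈ U(σ_w, Φ₂,w)` putting `B₀ = k⁻¹(s·ĝ_w)k` at depth `d₀ = 2n − 1` (★ `exists_centre_forall_v_rerootedCentred_sub_one_le_of_even_ram`), the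
re-rooted literal `γ′ = ι(B₀, 1)`, class constants `c₁ ε`, and a CLASS-BLIND per-vertex census of the `q + 1` root vertices `vtx ∈ R = {γ′·vtx = vtx ∧ SD ∧ LEV(ϖ^d₀)}`
(★ `ncard_rootRegion_hyperbolic_of_even_A_ram`): no E-grandchild (`#E(vtx) = 0`) and `#P(vtx) + #M(vtx) = q²` — THEN the socket count of `stub_Zhyp_zero_even_A` is
`#A = (q + 1)·Σ_{i<mA} q^{2i}`.  Proof: ★ raw head `hyperbolicTotal_zero_ram_of_region_census_odd` at root depth `2n − 1 = 2(mA − 1) + 3` (`mA ≥ 1` by ★ `typeTwo_two_le_n_of_even_ram`)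
with `sR := R`, `NE := 0`, `NP + NM = (q+1)q²`, and `(q+1)(1 + q²Σ_{i<mA−1} q^{2i}) = (q+1)Σ_{i<mA} q^{2i}`. [cite: Rogawski1990, §4.9 Prop. 4.9.1 (a) p. 55, Lemma 4.9.3 p. 56]
[cite: Kottwitz1986, §3] [cite: LabesseLanglands1979, §2 Lemma 2.1 p. 8] -/
theorem zhyp_zero_even_A_ram_of_topVertexCensus (he : v.asIdeal.ramificationIdx' w.1.asIdeal ≠ 1)
    (h2 : IsUnit (2 : (ValuativeRel.valuation (w.1.adicCompletion L)).integer))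
    (ϖ : w.1.adicCompletion L) (hϖ : Valued.v ϖ = WithZero.exp (-1 : ℤ)) (hσϖ : galAdicCompletionMap (L := L) (IsCMField.complexConj L) hw ϖ = -ϖ)
    (γH : (cmDatum L 2 (Matrix.of fun i j : Fin 2 => if i.val + j.val + 1 = 2 then (1 : L) else 0)).Local v ×
      (cmDatum L 1 (Matrix.of fun i j : Fin 1 => if i.val + j.val + 1 = 1 then (1 : L) else 0)).Local v)
    (hblk : ∀ i j : Fin 2, Valued.v (((((γH.1.val : GL (Fin 2) (UnitaryGroup.LocalRing L v)).val.map (Pi.evalRingHom (fun w' : PlacesOver L v => w'.1.adicCompletion L) w))) - 1) i j) ≤ Valued.v (ϖ ^ 2))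
    (hu2 : Valued.v (finGammaTwo L v γH w - 1) ≤ Valued.v (ϖ ^ 2))
    (hirr : ¬ ∃ x : (w.1.adicCompletion L), ((((γH.1.val : GL (Fin 2) (UnitaryGroup.LocalRing L v)).val.map (Pi.evalRingHom (fun w' : PlacesOver L v => w'.1.adicCompletion L) w))).charpoly).IsRoot x)
    {n : ℕ}
    (hdisc : Valued.v ((((γH.1.val : GL (Fin 2) (UnitaryGroup.LocalRing L v)).val.map (Pi.evalRingHom (fun w' : PlacesOver L v => w'.1.adicCompletion L) w))).trace ^ 2 -
      4 * (((γH.1.val : GL (Fin 2) (UnitaryGroup.LocalRing L v)).val.map (Pi.evalRingHom (fun w' : PlacesOver L v => w'.1.adicCompletion L) w))).det) = WithZero.exp (-((2 * (2 * n) : ℕ) : ℤ)))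
    (hn : 1 ≤ n)
    (m : ℕ) (hm : Valued.v (((finCharpolyTwo L v γH).eval (finGammaTwo L v γH)) w) =
      Valued.v ((toPlace v w (HeckeCharacter.uniformizer ↥(maximalRealSubfield L) v : v.adicCompletion ↥(maximalRealSubfield L))) ^ m))
    (β : (v.adicCompletion ↥(maximalRealSubfield L))ˣ)
    (hβ : toPlace v w (β : v.adicCompletion ↥(maximalRealSubfield L)) =
      -(((finCharpolyTwo L v γH).eval (finGammaTwo L v γH)) w *
          (finGammaTwo L v γH w ^ 2 + ((γH.1.val.val : Matrix (Fin 2) (Fin 2) (LocalRing L v)).map (Pi.evalRingHom (fun w' : PlacesOver L v => w'.1.adicCompletion L) w)).det)) /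
        (2 * finGammaTwo L v γH w ^ 2 * ((γH.1.val.val : Matrix (Fin 2) (Fin 2) (LocalRing L v)).map (Pi.evalRingHom (fun w' : PlacesOver L v => w'.1.adicCompletion L) w)).det))
    (s : (w.1.adicCompletion L)ˣ)
    (hs : (s : w.1.adicCompletion L) * (((localNonsplitEquiv (IsCMField.complexConj L) (Matrix.of fun i j : Fin 1 => if i.val + j.val + 1 = 1 then (1 : L) else 0) (IsCMField.complexConj_ne_one L) w hw γH.2).val : GL (Fin 1) (w.1.adicCompletion L)) : Matrix (Fin 1) (Fin 1) (w.1.adicCompletion L)) 0 0 = 1)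
    (k : GL (Fin 2) (w.1.adicCompletion L))
    (hk : k ∈ unitaryGroupOfForm (galAdicCompletionMap (L := L) (IsCMField.complexConj L) hw)
      (placeForm (Matrix.of fun i j : Fin 2 => if i.val + j.val + 1 = 2 then (1 : L) else 0) w.1))
    {d₀ : ℕ} (hd₀ : d₀ + 1 = 2 * n)
    (hd : ∀ i j, Valued.v (((((k⁻¹ * (Matrix.GeneralLinearGroup.scalar (Fin 2) s * ((localNonsplitEquiv (IsCMField.complexConj L) (Matrix.of fun i j : Fin 2 => if i.val + j.val + 1 = 2 then (1 : L) else 0) (IsCMField.complexConj_ne_one L) w hw γH.1).val : GL (Fin 2) (w.1.adicCompletion L))) * k) : GL (Fin 2) (w.1.adicCompletion L)) : Matrix (Fin 2) (Fin 2) (w.1.adicCompletion L)) - 1) i j) ≤ Valued.v ϖ ^ d₀)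
    (γ' : unitaryGroupOfForm (galAdicCompletionMap (L := L) (IsCMField.complexConj L) hw) ((StdForm.antidiagonal 3).over (w.1.adicCompletion L)))
    (hγ' : (γ' : GL (Fin 3) (w.1.adicCompletion L)) = endoGL ((k⁻¹ * (Matrix.GeneralLinearGroup.scalar (Fin 2) s * ((localNonsplitEquiv (IsCMField.complexConj L) (Matrix.of fun i j : Fin 2 => if i.val + j.val + 1 = 2 then (1 : L) else 0) (IsCMField.complexConj_ne_one L) w hw γH.1).val : GL (Fin 2) (w.1.adicCompletion L))) * k), (1 : GL (Fin 1) (w.1.adicCompletion L))))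
    (c₁ ε : w.1.adicCompletion L) (hc₁ : Valued.v c₁ = 1) (hεv : Valued.v ε = 1) (hε : ∀ z : (w.1.adicCompletion L), Valued.v z ≤ 1 → Valued.v (z ^ 2 - ε) = 1)
    (q : ℕ) (hq : (q : ℂ) = (Ideal.absNorm v.asIdeal : ℂ))
    (hE0 : ∀ vtx ∈ {vtx : {M : Submodule (Valued.integer (w.1.adicCompletion L)) (Fin 3 → (w.1.adicCompletion L)) // IsVertex (galAdicCompletionMap (L := L) (IsCMField.complexConj L) hw) ϖ ((StdForm.antidiagonal 3).over (w.1.adicCompletion L)) M} | latticeGraphIso (galAdicCompletionMap (L := L) (IsCMField.complexConj L) hw) ϖ ((StdForm.antidiagonal 3).over (w.1.adicCompletion L)) γ' vtx = vtx ∧ IsSelfDualLattice (galAdicCompletionMap (L := L) (IsCMField.complexConj L) hw) ϖ ((StdForm.antidiagonal 3).over (w.1.adicCompletion L)) vtx.1 ∧ vtx.1.map ((Matrix.toLin' (((γ' : GL (Fin 3) (w.1.adicCompletion L)) : Matrix (Fin 3) (Fin 3) (w.1.adicCompletion L)) - 1)).restrictScalars (Valued.integer (w.1.adicCompletion L)))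 ≤ scaleLattice (ϖ ^ d₀) vtx.1},
      ({wtx | wtx ∈ {wtx | ∃ cx, ((latticeGraph (galAdicCompletionMap (L := L) (IsCMField.complexConj L) hw) ϖ ((StdForm.antidiagonal 3).over (w.1.adicCompletion L))).Adj vtx cx ∧ (latticeGraph (galAdicCompletionMap (L := L) (IsCMField.complexConj L) hw) ϖ ((StdForm.antidiagonal 3).over (w.1.adicCompletion L))).dist ⟨stdLattice (w.1.adicCompletion L) 3, 0, isSelfDualLattice_stdLattice_three_of_v hϖ⟩ cx = (latticeGraph (galAdicCompletionMap (L := L) (IsCMField.complexConj L) hw) ϖ ((StdForm.antidiagonal 3).over (w.1.adicCompletion L))).dist ⟨stdLattice (w.1.adicCompletion L) 3, 0, isSelfDualLattice_stdLattice_three_of_v hϖ⟩ vtx + 1 ∧ latticeGraphIso (galAdicCompletionMap (L := L) (IsCMField.complexConj L) hw) ϖ ((StdForm.antidiagonal 3).over (w.1.adicCompletion L)) γ' cx = cx) ∧ ((latticeGraph (galAdicCompletionMap (L := L) (IsCMField.complexConj L) hw) ϖ ((StdForm.antidiagonal 3).over (w.1.adicCompletion L))).Adj cx wtx ∧ (latticeGraph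 (galAdicCompletionMap (L := L) (IsCMField.complexConj L) hw) ϖ ((StdForm.antidiagonal 3).over (w.1.adicCompletion L))).dist ⟨stdLattice (w.1.adicCompletion L) 3, 0, isSelfDualLattice_stdLattice_three_of_v hϖ⟩ wtx = (latticeGraph (galAdicCompletionMap (L := L) (IsCMField.complexConj L) hw) ϖ ((StdForm.antidiagonal 3).over (w.1.adicCompletion L))).dist ⟨stdLattice (w.1.adicCompletion L) 3, 0, isSelfDualLattice_stdLattice_three_of_v hϖ⟩ cx + 1 ∧ latticeGraphIso (galAdicCompletionMap (L := L) (IsCMField.complexConj L) hw) ϖ ((StdForm.antidiagonal 3).over (w.1.adicCompletion L)) γ' wtx = wtx)} ∧ (¬ wtx.1.map ((Matrix.toLin' (((γ' : GL (Fin 3) (w.1.adicCompletion L)) : Matrix (Fin 3) (Fin 3) (w.1.adicCompletion L)) - 1)).restrictScalars (Valued.integer (w.1.adicCompletion L))) ≤ scaleLattice (ϖ ^ d₀) wtx.1 ∧ (wtx.1.map ((Matrix.toLin' (((γ' : GL (Fin 3) (w.1.adicCompletion L)) : Matrix (Fin 3) (Fin 3) (w.1.adicCompletion L)) - 1)).restrictScalars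 (Valued.integer (w.1.adicCompletion L))) ≤ scaleLattice (ϖ ^ (d₀ - 1)) wtx.1 ∧ ¬ wtx.1.map ((Matrix.toLin' (((γ' : GL (Fin 3) (w.1.adicCompletion L)) : Matrix (Fin 3) (Fin 3) (w.1.adicCompletion L)) - 1)).restrictScalars (Valued.integer (w.1.adicCompletion L))) ≤ scaleLattice (ϖ ^ d₀) wtx.1))}).ncard = 0)
    (hPM : ∀ vtx ∈ {vtx : {M : Submodule (Valued.integer (w.1.adicCompletion L)) (Fin 3 → (w.1.adicCompletion L)) // IsVertex (galAdicCompletionMap (L := L) (IsCMField.complexConj L) hw) ϖ ((StdForm.antidiagonal 3).over (w.1.adicCompletion L)) M} | latticeGraphIso (galAdicCompletionMap (L := L) (IsCMField.complexConj L) hw) ϖ ((StdForm.antidiagonal 3).over (w.1.adicCompletion L)) γ' vtx = vtx ∧ IsSelfDualLattice (galAdicCompletionMap (L := L) (IsCMField.complexConj L) hw) ϖ ((StdForm.antidiagonal 3).over (w.1.adicCompletion L)) vtx.1 ∧ vtx.1.map ((Matrix.toLin' (((γ' : GL (Fin 3) (w.1.adicCompletion L)) : Matrix (Fin 3) (Fin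 3) (w.1.adicCompletion L)) - 1)).restrictScalars (Valued.integer (w.1.adicCompletion L))) ≤ scaleLattice (ϖ ^ d₀) vtx.1},
      ({wtx | wtx ∈ {wtx | ∃ cx, ((latticeGraph (galAdicCompletionMap (L := L) (IsCMField.complexConj L) hw) ϖ ((StdForm.antidiagonal 3).over (w.1.adicCompletion L))).Adj vtx cx ∧ (latticeGraph (galAdicCompletionMap (L := L) (IsCMField.complexConj L) hw) ϖ ((StdForm.antidiagonal 3).over (w.1.adicCompletion L))).dist ⟨stdLattice (w.1.adicCompletion L) 3, 0, isSelfDualLattice_stdLattice_three_of_v hϖ⟩ cx = (latticeGraph (galAdicCompletionMap (L := L) (IsCMField.complexConj L) hw) ϖ ((StdForm.antidiagonal 3).over (w.1.adicCompletion L))).dist ⟨stdLattice (w.1.adicCompletion L) 3, 0, isSelfDualLattice_stdLattice_three_of_v hϖ⟩ vtx + 1 ∧ latticeGraphIso (galAdicCompletionMap (L := L) (IsCMField.complexConj L) hw) ϖ ((StdForm.antidiagonal 3).over (w.1.adicCompletion L)) γ' cx = cx) ∧ ((latticeGraph (galAdicCompletionMap (L := L) (IsCMField.complexConj L) hw) ϖ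 ((StdForm.antidiagonal 3).over (w.1.adicCompletion L))).Adj cx wtx ∧ (latticeGraph (galAdicCompletionMap (L := L) (IsCMField.complexConj L) hw) ϖ ((StdForm.antidiagonal 3).over (w.1.adicCompletion L))).dist ⟨stdLattice (w.1.adicCompletion L) 3, 0, isSelfDualLattice_stdLattice_three_of_v hϖ⟩ wtx = (latticeGraph (galAdicCompletionMap (L := L) (IsCMField.complexConj L) hw) ϖ ((StdForm.antidiagonal 3).over (w.1.adicCompletion L))).dist ⟨stdLattice (w.1.adicCompletion L) 3, 0, isSelfDualLattice_stdLattice_three_of_v hϖ⟩ cx + 1 ∧ latticeGraphIso (galAdicCompletionMap (L := L) (IsCMField.complexConj L) hw) ϖ ((StdForm.antidiagonal 3).over (w.1.adicCompletion L)) γ' wtx = wtx)} ∧ (¬ wtx.1.map ((Matrix.toLin' (((γ' : GL (Fin 3) (w.1.adicCompletion L)) : Matrix (Fin 3) (Fin 3) (w.1.adicCompletion L)) - 1)).restrictScalars (Valued.integer (w.1.adicCompletion L))) ≤ scaleLattice (ϖ ^ d₀) wtx.1 ∧ (wtx.1.map ((Matrix.toLin' (((γ' : GL (Fin 3) (w.1.adicCompletion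 L)) : Matrix (Fin 3) (Fin 3) (w.1.adicCompletion L)) - 1)).restrictScalars (Valued.integer (w.1.adicCompletion L))) ≤ scaleLattice (ϖ ^ (d₀ - 2)) wtx.1 ∧ ¬ wtx.1.map ((Matrix.toLin' (((γ' : GL (Fin 3) (w.1.adicCompletion L)) : Matrix (Fin 3) (Fin 3) (w.1.adicCompletion L)) - 1)).restrictScalars (Valued.integer (w.1.adicCompletion L))) ≤ scaleLattice (ϖ ^ (d₀ - 1)) wtx.1) ∧ ∃ y ∈ wtx.1, ∃ a : (w.1.adicCompletion L), Valued.v a = 1 ∧ Valued.v ((ϖ ^ (d₀ - 2))⁻¹ * pairing (galAdicCompletionMap (L := L) (IsCMField.complexConj L) hw) ((StdForm.antidiagonal 3).over (w.1.adicCompletion L)) y ((((γ' : GL (Fin 3) (w.1.adicCompletion L)) : Matrix (Fin 3) (Fin 3) (w.1.adicCompletion L)) - 1) *ᵥ y) - (c₁) * a ^ 2) < 1)}).ncard +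
        ({wtx | wtx ∈ {wtx | ∃ cx, ((latticeGraph (galAdicCompletionMap (L := L) (IsCMField.complexConj L) hw) ϖ ((StdForm.antidiagonal 3).over (w.1.adicCompletion L))).Adj vtx cx ∧ (latticeGraph (galAdicCompletionMap (L := L) (IsCMField.complexConj L) hw) ϖ ((StdForm.antidiagonal 3).over (w.1.adicCompletion L))).dist ⟨stdLattice (w.1.adicCompletion L) 3, 0, isSelfDualLattice_stdLattice_three_of_v hϖ⟩ cx = (latticeGraph (galAdicCompletionMap (L := L) (IsCMField.complexConj L) hw) ϖ ((StdForm.antidiagonal 3).over (w.1.adicCompletion L))).dist ⟨stdLattice (w.1.adicCompletion L) 3, 0, isSelfDualLattice_stdLattice_three_of_v hϖ⟩ vtx + 1 ∧ latticeGraphIso (galAdicCompletionMap (L := L) (IsCMField.complexConj L) hw) ϖ ((StdForm.antidiagonal 3).over (w.1.adicCompletion L)) γ' cx = cx) ∧ ((latticeGraph (galAdicCompletionMap (L := L) (IsCMField.complexConj L) hw) ϖ ((StdForm.antidiagonal 3).over (w.1.adicCompletion L))).Adj cx wtx ∧ (latticeGraph (galAdicCompletionMap (L := L) (IsCMField.complexConj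 L) hw) ϖ ((StdForm.antidiagonal 3).over (w.1.adicCompletion L))).dist ⟨stdLattice (w.1.adicCompletion L) 3, 0, isSelfDualLattice_stdLattice_three_of_v hϖ⟩ wtx = (latticeGraph (galAdicCompletionMap (L := L) (IsCMField.complexConj L) hw) ϖ ((StdForm.antidiagonal 3).over (w.1.adicCompletion L))).dist ⟨stdLattice (w.1.adicCompletion L) 3, 0, isSelfDualLattice_stdLattice_three_of_v hϖ⟩ cx + 1 ∧ latticeGraphIso (galAdicCompletionMap (L := L) (IsCMField.complexConj L) hw) ϖ ((StdForm.antidiagonal 3).over (w.1.adicCompletion L)) γ' wtx = wtx)} ∧ (¬ wtx.1.map ((Matrix.toLin' (((γ' : GL (Fin 3) (w.1.adicCompletion L)) : Matrix (Fin 3) (Fin 3) (w.1.adicCompletion L)) - 1)).restrictScalars (Valued.integer (w.1.adicCompletion L))) ≤ scaleLattice (ϖ ^ d₀) wtx.1 ∧ (wtx.1.map ((Matrix.toLin' (((γ' : GL (Fin 3) (w.1.adicCompletion L)) : Matrix (Fin 3) (Fin 3) (w.1.adicCompletion L)) - 1)).restrictScalars (Valued.integer (w.1.adicCompletion L))) ≤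 scaleLattice (ϖ ^ (d₀ - 2)) wtx.1 ∧ ¬ wtx.1.map ((Matrix.toLin' (((γ' : GL (Fin 3) (w.1.adicCompletion L)) : Matrix (Fin 3) (Fin 3) (w.1.adicCompletion L)) - 1)).restrictScalars (Valued.integer (w.1.adicCompletion L))) ≤ scaleLattice (ϖ ^ (d₀ - 1)) wtx.1) ∧ ¬ (∃ y ∈ wtx.1, ∃ a : (w.1.adicCompletion L), Valued.v a = 1 ∧ Valued.v ((ϖ ^ (d₀ - 2))⁻¹ * pairing (galAdicCompletionMap (L := L) (IsCMField.complexConj L) hw) ((StdForm.antidiagonal 3).over (w.1.adicCompletion L)) y ((((γ' : GL (Fin 3) (w.1.adicCompletion L)) : Matrix (Fin 3) (Fin 3) (w.1.adicCompletion L)) - 1) *ᵥ y) - (c₁) * a ^ 2) < 1))}).ncard = q ^ 2)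
    (mA : ℕ) (hnA : n = mA + 1) (hmN : m = 2 * n) :
    ({M : Submodule (Valued.integer (w.1.adicCompletion L)) (Fin 3 → (w.1.adicCompletion L)) | IsSelfDualLattice (galAdicCompletionMap (L := L) (IsCMField.complexConj L) hw) ϖ (placeForm (Matrix.of fun i j : Fin 3 => if i.val + j.val + 1 = 3 then (1 : L) else 0) w.1) M ∧ mapGL (endoGL (((localNonsplitEquiv (IsCMField.complexConj L) (Matrix.of fun i j : Fin 2 => if i.val + j.val + 1 = 2 then (1 : L) else 0) (IsCMField.complexConj_ne_one L) w hw γH.1).val : GL (Fin 2) (w.1.adicCompletion L)), ((localNonsplitEquiv (IsCMField.complexConj L) (Matrix.of fun i j : Fin 1 => if i.val + j.val + 1 = 1 then (1 : L) else 0) (IsCMField.complexConj_ne_one L) w hw γH.2).val : GL (Fin 1) (w.1.adicCompletion L)))) M = M ∧ M.map ((Matrix.toLin' (((endoGL (((localNonsplitEquiv (IsCMField.complexConj L) (Matrix.of fun i j : Fin 2 => if i.val + j.val + 1 = 2 then (1 : L) else 0) (IsCMField.complexConj_ne_one L) w hw γH.1).val : GL (Fin 2) (w.1.adicCompletion L)),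 ((localNonsplitEquiv (IsCMField.complexConj L) (Matrix.of fun i j : Fin 1 => if i.val + j.val + 1 = 1 then (1 : L) else 0) (IsCMField.complexConj_ne_one L) w hw γH.2).val : GL (Fin 1) (w.1.adicCompletion L))) : GL (Fin 3) (w.1.adicCompletion L)) : Matrix (Fin 3) (Fin 3) (w.1.adicCompletion L)) - 1)).restrictScalars (Valued.integer (w.1.adicCompletion L))) ≤ scaleLattice (ϖ ^ 2) M}.ncard : ℂ) =
      ((Ideal.absNorm v.asIdeal : ℂ) + 1) * ∑ i ∈ Finset.range mA, (Ideal.absNorm v.asIdeal : ℂ) ^ (2 * i) := by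
  classical
  have hn2 : 2 ≤ n := typeTwo_two_le_n_of_even_ram L w hw he h2 ϖ hϖ hσϖ hblk hirr hdisc hn
  obtain ⟨mA', rfl⟩ : ∃ mA' : ℕ, mA = mA' + 1 := ⟨mA - 1, by omega⟩
  obtain rfl : d₀ = 2 * n - 1 := by omega
  -- `#R = q + 1` (★ p849413), so `R` is finite
  have hR := ncard_rootRegion_hyperbolic_of_even_A_ram L w hw he h2 ϖ hϖ hσϖ γH hblk hu2 hirr hdisc hn m hm β hβ s hs k hk γ' hγ' hmN
  have hRfin := Set.finite_of_ncard_ne_zero (ne_of_eq_of_ne hR (Nat.succ_ne_zero _))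
  -- the class-blind pooled atom `NP + NM = #R · q²`
  have hsumN := Finset.sum_congr rfl fun vtx hv => hPM vtx (hRfin.mem_toFinset.1 hv)
  rw [Finset.sum_add_distrib, Finset.sum_const, smul_eq_mul] at hsumN
  -- ★ raw head at root depth `2n − 1 = 2mA' + 3`, `sR := R`, `NE := 0`
  have key := hyperbolicTotal_zero_ram_of_region_census_odd L w hw he h2 ϖ hϖ hσϖ γH hu2 hirr (2 * n - 1) mA' (by omega) s hs k hk hd γ' hγ' c₁ ε hc₁ hεv hε
    hRfin.toFinset (fun vtx => hRfin.mem_toFinset) 0 _ _ (Finset.sum_eq_zero fun vtx hv => hE0 vtx (hRfin.mem_toFinset.1 hv)) rfl rfl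
  refine key.trans ?_
  simp only [Nat.cast_zero, zero_mul, add_zero]
  -- casts: everything in `ℕ` first (no `rw` of `Nat.cast` patterns next to the pooled sums)
  have hq' : ((Nat.card (𝓞 ↥(maximalRealSubfield L) ⧸ v.asIdeal) : ℕ) : ℂ) = (Ideal.absNorm v.asIdeal : ℂ) := by
    rw [Ideal.absNorm_apply, Submodule.cardQuot_apply]
  have hcardN : hRfin.toFinset.card = Nat.card (𝓞 ↥(maximalRealSubfield L) ⧸ v.asIdeal) + 1 := by
    rw [← Set.ncard_eq_toFinset_card _ hRfin, hR]
  rw [hcardN] at hsumN ⊢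
  have hsumC := congrArg (Nat.cast : ℕ → ℂ) hsumN
  simp only [Nat.cast_add, Nat.cast_mul, Nat.cast_pow, Nat.cast_one, hq', hq] at hsumC
  simp only [Nat.cast_add, Nat.cast_one, hq']
  have hS : ∑ i ∈ Finset.range (mA' + 1), (Ideal.absNorm v.asIdeal : ℂ) ^ (2 * i) =
      1 + (Ideal.absNorm v.asIdeal : ℂ) ^ 2 * ∑ i ∈ Finset.range mA', (Ideal.absNorm v.asIdeal : ℂ) ^ (2 * i) := by
    rw [Finset.sum_range_succ', mul_zero, pow_zero, add_comm, Finset.mul_sum]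
    exact congrArg _ (Finset.sum_congr rfl fun i _ => by ring)
  rw [hS]
  linear_combination (∑ i ∈ Finset.range mA', (Ideal.absNorm v.asIdeal : ℂ) ^ (2 * i)) * hsumC

set_option maxHeartbeats 3200000 in
-- budget only: statement-heavy lattice tokens (the ★ pm head's texts, per vertex; the head's own budget ×2 for the per-vertex hypotheses).
/-- **THE A-EVEN ROW-`±` CELL OVER A PER-VERTEX TOP CENSUS BY KIND.**  As `zhyp_zero_even_A_ram_of_topVertexCensus`, with a class constant `c` (`|c| = 1`), a KIND `Q` on
vertices holding on exactly half of the `q + 1` root vertices (`2·#{vtx ∈ R ∣ Q vtx} = q + 1`, F0P3a-p05 (g18) ★ `two_mul_ncard_rootRegion_class_eq_of_top_of_even_depth_ramified` for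
`Q :=` the vertex class token), and the kind-keyed per-vertex census `#E(vtx) = 0`, `#P_c(vtx) = q²·[Q vtx]`, `#M_c(vtx) = q²·[¬Q vtx]` — THEN both class counts of
`stub_Zhyp_pm_even_A` are `#A₊ = #A₋ = (q + 1)∕2 · q^{2mA}`.  Proof: ★ pm head `hyperbolicTotal_pm_ram_of_region_census_odd` (F0P3a-p08 (g20)) at root depth `2n − 1 = 2(mA − 1) + 3`
with `NE := 0`, `NP = NM = (q+1)q²∕2` (so its residual `if` is idle). [cite: Rogawski1990, §4.9 Prop. 4.9.1 (a) p. 55, Lemma 4.9.3 p. 56] [cite: Kottwitz1986, §3]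
[cite: LabesseLanglands1979, §2 Lemma 2.1 p. 8] -/
theorem zhyp_pm_even_A_ram_of_topVertexCensus (he : v.asIdeal.ramificationIdx' w.1.asIdeal ≠ 1)
    (h2 : IsUnit (2 : (ValuativeRel.valuation (w.1.adicCompletion L)).integer))
    (ϖ : w.1.adicCompletion L) (hϖ : Valued.v ϖ = WithZero.exp (-1 : ℤ)) (hσϖ : galAdicCompletionMap (L := L) (IsCMField.complexConj L) hw ϖ = -ϖ)
    (γH : (cmDatum L 2 (Matrix.of fun i j : Fin 2 => if i.val + j.val + 1 = 2 then (1 : L) else 0)).Local v ×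
      (cmDatum L 1 (Matrix.of fun i j : Fin 1 => if i.val + j.val + 1 = 1 then (1 : L) else 0)).Local v)
    (hblk : ∀ i j : Fin 2, Valued.v (((((γH.1.val : GL (Fin 2) (UnitaryGroup.LocalRing L v)).val.map (Pi.evalRingHom (fun w' : PlacesOver L v => w'.1.adicCompletion L) w))) - 1) i j) ≤ Valued.v (ϖ ^ 2))
    (hu2 : Valued.v (finGammaTwo L v γH w - 1) ≤ Valued.v (ϖ ^ 2))
    (hirr : ¬ ∃ x : (w.1.adicCompletion L), ((((γH.1.val : GL (Fin 2) (UnitaryGroup.LocalRing L v)).val.map (Pi.evalRingHom (fun w' : PlacesOver L v => w'.1.adicCompletion L) w))).charpoly).IsRoot x)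
    {n : ℕ}
    (hdisc : Valued.v ((((γH.1.val : GL (Fin 2) (UnitaryGroup.LocalRing L v)).val.map (Pi.evalRingHom (fun w' : PlacesOver L v => w'.1.adicCompletion L) w))).trace ^ 2 -
      4 * (((γH.1.val : GL (Fin 2) (UnitaryGroup.LocalRing L v)).val.map (Pi.evalRingHom (fun w' : PlacesOver L v => w'.1.adicCompletion L) w))).det) = WithZero.exp (-((2 * (2 * n) : ℕ) : ℤ)))
    (hn : 1 ≤ n)
    (m : ℕ) (hm : Valued.v (((finCharpolyTwo L v γH).eval (finGammaTwo L v γH)) w) =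
      Valued.v ((toPlace v w (HeckeCharacter.uniformizer ↥(maximalRealSubfield L) v : v.adicCompletion ↥(maximalRealSubfield L))) ^ m))
    (β : (v.adicCompletion ↥(maximalRealSubfield L))ˣ)
    (hβ : toPlace v w (β : v.adicCompletion ↥(maximalRealSubfield L)) =
      -(((finCharpolyTwo L v γH).eval (finGammaTwo L v γH)) w *
          (finGammaTwo L v γH w ^ 2 + ((γH.1.val.val : Matrix (Fin 2) (Fin 2) (LocalRing L v)).map (Pi.evalRingHom (fun w' : PlacesOver L v => w'.1.adicCompletion L) w)).det)) /
        (2 * finGammaTwo L v γH w ^ 2 * ((γH.1.val.val : Matrix (Fin 2) (Fin 2) (LocalRing L v)).map (Pi.evalRingHom (fun w' : PlacesOver L v => w'.1.adicCompletion L) w)).det))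
    (s : (w.1.adicCompletion L)ˣ)
    (hs : (s : w.1.adicCompletion L) * (((localNonsplitEquiv (IsCMField.complexConj L) (Matrix.of fun i j : Fin 1 => if i.val + j.val + 1 = 1 then (1 : L) else 0) (IsCMField.complexConj_ne_one L) w hw γH.2).val : GL (Fin 1) (w.1.adicCompletion L)) : Matrix (Fin 1) (Fin 1) (w.1.adicCompletion L)) 0 0 = 1)
    (k : GL (Fin 2) (w.1.adicCompletion L))
    (hk : k ∈ unitaryGroupOfForm (galAdicCompletionMap (L := L) (IsCMField.complexConj L) hw)
      (placeForm (Matrix.of fun i j : Fin 2 => if i.val + j.val + 1 = 2 then (1 : L) else 0) w.1))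
    {d₀ : ℕ} (hd₀ : d₀ + 1 = 2 * n)
    (hd : ∀ i j, Valued.v (((((k⁻¹ * (Matrix.GeneralLinearGroup.scalar (Fin 2) s * ((localNonsplitEquiv (IsCMField.complexConj L) (Matrix.of fun i j : Fin 2 => if i.val + j.val + 1 = 2 then (1 : L) else 0) (IsCMField.complexConj_ne_one L) w hw γH.1).val : GL (Fin 2) (w.1.adicCompletion L))) * k) : GL (Fin 2) (w.1.adicCompletion L)) : Matrix (Fin 2) (Fin 2) (w.1.adicCompletion L)) - 1) i j) ≤ Valued.v ϖ ^ d₀)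
    (γ' : unitaryGroupOfForm (galAdicCompletionMap (L := L) (IsCMField.complexConj L) hw) ((StdForm.antidiagonal 3).over (w.1.adicCompletion L)))
    (hγ' : (γ' : GL (Fin 3) (w.1.adicCompletion L)) = endoGL ((k⁻¹ * (Matrix.GeneralLinearGroup.scalar (Fin 2) s * ((localNonsplitEquiv (IsCMField.complexConj L) (Matrix.of fun i j : Fin 2 => if i.val + j.val + 1 = 2 then (1 : L) else 0) (IsCMField.complexConj_ne_one L) w hw γH.1).val : GL (Fin 2) (w.1.adicCompletion L))) * k), (1 : GL (Fin 1) (w.1.adicCompletion L))))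
    (c ε : w.1.adicCompletion L) (hc : Valued.v c = 1) (hεv : Valued.v ε = 1) (hε : ∀ z : (w.1.adicCompletion L), Valued.v z ≤ 1 → Valued.v (z ^ 2 - ε) = 1)
    (q : ℕ) (hq : (q : ℂ) = (Ideal.absNorm v.asIdeal : ℂ))
    (Q : {M : Submodule (Valued.integer (w.1.adicCompletion L)) (Fin 3 → (w.1.adicCompletion L)) // IsVertex (galAdicCompletionMap (L := L) (IsCMField.complexConj L) hw) ϖ ((StdForm.antidiagonal 3).over (w.1.adicCompletion L)) M} → Prop)
    (hQ : 2 * {vtx | vtx ∈ {vtx : {M : Submodule (Valued.integer (w.1.adicCompletion L)) (Fin 3 → (w.1.adicCompletion L)) // IsVertex (galAdicCompletionMap (L := L) (IsCMField.complexConj L) hw) ϖ ((StdForm.antidiagonal 3).over (w.1.adicCompletion L)) M} | latticeGraphIso (galAdicCompletionMap (L := L) (IsCMField.complexConj L) hw) ϖ ((StdForm.antidiagonal 3).over (w.1.adicCompletion L)) γ' vtx = vtx ∧ IsSelfDualLattice (galAdicCompletionMap (L := L) (IsCMField.complexConj L) hw) ϖ ((StdForm.antidiagonal 3).over (w.1.adicCompletion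 L)) vtx.1 ∧ vtx.1.map ((Matrix.toLin' (((γ' : GL (Fin 3) (w.1.adicCompletion L)) : Matrix (Fin 3) (Fin 3) (w.1.adicCompletion L)) - 1)).restrictScalars (Valued.integer (w.1.adicCompletion L))) ≤ scaleLattice (ϖ ^ d₀) vtx.1} ∧ Q vtx}.ncard = Nat.card (𝓞 ↥(maximalRealSubfield L) ⧸ v.asIdeal) + 1)
    (hE0 : ∀ vtx ∈ {vtx : {M : Submodule (Valued.integer (w.1.adicCompletion L)) (Fin 3 → (w.1.adicCompletion L)) // IsVertex (galAdicCompletionMap (L := L) (IsCMField.complexConj L) hw) ϖ ((StdForm.antidiagonal 3).over (w.1.adicCompletion L)) M} | latticeGraphIso (galAdicCompletionMap (L := L) (IsCMField.complexConj L) hw) ϖ ((StdForm.antidiagonal 3).over (w.1.adicCompletion L)) γ' vtx = vtx ∧ IsSelfDualLattice (galAdicCompletionMap (L := L) (IsCMField.complexConj L) hw) ϖ ((StdForm.antidiagonal 3).over (w.1.adicCompletion L)) vtx.1 ∧ vtx.1.map ((Matrix.toLin' (((γ' : GL (Fin 3) (w.1.adicCompletion L)) : Matrix (Fin 3) (Fin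 3) (w.1.adicCompletion L)) - 1)).restrictScalars (Valued.integer (w.1.adicCompletion L))) ≤ scaleLattice (ϖ ^ d₀) vtx.1},
      ({wtx | wtx ∈ {wtx | ∃ cx, ((latticeGraph (galAdicCompletionMap (L := L) (IsCMField.complexConj L) hw) ϖ ((StdForm.antidiagonal 3).over (w.1.adicCompletion L))).Adj vtx cx ∧ (latticeGraph (galAdicCompletionMap (L := L) (IsCMField.complexConj L) hw) ϖ ((StdForm.antidiagonal 3).over (w.1.adicCompletion L))).dist ⟨stdLattice (w.1.adicCompletion L) 3, 0, isSelfDualLattice_stdLattice_three_of_v hϖ⟩ cx = (latticeGraph (galAdicCompletionMap (L := L) (IsCMField.complexConj L) hw) ϖ ((StdForm.antidiagonal 3).over (w.1.adicCompletion L))).dist ⟨stdLattice (w.1.adicCompletion L) 3, 0, isSelfDualLattice_stdLattice_three_of_v hϖ⟩ vtx + 1 ∧ latticeGraphIso (galAdicCompletionMap (L := L) (IsCMField.complexConj L) hw) ϖ ((StdForm.antidiagonal 3).over (w.1.adicCompletion L)) γ' cx = cx) ∧ ((latticeGraph (galAdicCompletionMap (L := L) (IsCMField.complexConj L) hw) ϖ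 ((StdForm.antidiagonal 3).over (w.1.adicCompletion L))).Adj cx wtx ∧ (latticeGraph (galAdicCompletionMap (L := L) (IsCMField.complexConj L) hw) ϖ ((StdForm.antidiagonal 3).over (w.1.adicCompletion L))).dist ⟨stdLattice (w.1.adicCompletion L) 3, 0, isSelfDualLattice_stdLattice_three_of_v hϖ⟩ wtx = (latticeGraph (galAdicCompletionMap (L := L) (IsCMField.complexConj L) hw) ϖ ((StdForm.antidiagonal 3).over (w.1.adicCompletion L))).dist ⟨stdLattice (w.1.adicCompletion L) 3, 0, isSelfDualLattice_stdLattice_three_of_v hϖ⟩ cx + 1 ∧ latticeGraphIso (galAdicCompletionMap (L := L) (IsCMField.complexConj L) hw) ϖ ((StdForm.antidiagonal 3).over (w.1.adicCompletion L)) γ' wtx = wtx)} ∧ (¬ wtx.1.map ((Matrix.toLin' (((γ' : GL (Fin 3) (w.1.adicCompletion L)) : Matrix (Fin 3) (Fin 3) (w.1.adicCompletion L)) - 1)).restrictScalars (Valued.integer (w.1.adicCompletion L))) ≤ scaleLattice (ϖ ^ d₀) wtx.1 ∧ (wtx.1.map ((Matrix.toLin' (((γ' : GL (Fin 3) (w.1.adicCompletion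 L)) : Matrix (Fin 3) (Fin 3) (w.1.adicCompletion L)) - 1)).restrictScalars (Valued.integer (w.1.adicCompletion L))) ≤ scaleLattice (ϖ ^ (d₀ - 1)) wtx.1 ∧ ¬ wtx.1.map ((Matrix.toLin' (((γ' : GL (Fin 3) (w.1.adicCompletion L)) : Matrix (Fin 3) (Fin 3) (w.1.adicCompletion L)) - 1)).restrictScalars (Valued.integer (w.1.adicCompletion L))) ≤ scaleLattice (ϖ ^ d₀) wtx.1))}).ncard = 0)
    (hPQ : ∀ vtx ∈ {vtx : {M : Submodule (Valued.integer (w.1.adicCompletion L)) (Fin 3 → (w.1.adicCompletion L)) // IsVertex (galAdicCompletionMap (L := L) (IsCMField.complexConj L) hw) ϖ ((StdForm.antidiagonal 3).over (w.1.adicCompletion L)) M} | latticeGraphIso (galAdicCompletionMap (L := L) (IsCMField.complexConj L) hw) ϖ ((StdForm.antidiagonal 3).over (w.1.adicCompletion L)) γ' vtx = vtx ∧ IsSelfDualLattice (galAdicCompletionMap (L := L) (IsCMField.complexConj L) hw) ϖ ((StdForm.antidiagonal 3).over (w.1.adicCompletion L)) vtx.1 ∧ vtx.1.map ((Matrix.toLin'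 (((γ' : GL (Fin 3) (w.1.adicCompletion L)) : Matrix (Fin 3) (Fin 3) (w.1.adicCompletion L)) - 1)).restrictScalars (Valued.integer (w.1.adicCompletion L))) ≤ scaleLattice (ϖ ^ d₀) vtx.1}, Q vtx →
      ({wtx | wtx ∈ {wtx | ∃ cx, ((latticeGraph (galAdicCompletionMap (L := L) (IsCMField.complexConj L) hw) ϖ ((StdForm.antidiagonal 3).over (w.1.adicCompletion L))).Adj vtx cx ∧ (latticeGraph (galAdicCompletionMap (L := L) (IsCMField.complexConj L) hw) ϖ ((StdForm.antidiagonal 3).over (w.1.adicCompletion L))).dist ⟨stdLattice (w.1.adicCompletion L) 3, 0, isSelfDualLattice_stdLattice_three_of_v hϖ⟩ cx = (latticeGraph (galAdicCompletionMap (L := L) (IsCMField.complexConj L) hw) ϖ ((StdForm.antidiagonal 3).over (w.1.adicCompletion L))).dist ⟨stdLattice (w.1.adicCompletion L) 3, 0, isSelfDualLattice_stdLattice_three_of_v hϖ⟩ vtx + 1 ∧ latticeGraphIso (galAdicCompletionMap (L := L) (IsCMField.complexConj L) hw) ϖ ((StdForm.antidiagonal 3).over (w.1.adicCompletion L)) γ'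 cx = cx) ∧ ((latticeGraph (galAdicCompletionMap (L := L) (IsCMField.complexConj L) hw) ϖ ((StdForm.antidiagonal 3).over (w.1.adicCompletion L))).Adj cx wtx ∧ (latticeGraph (galAdicCompletionMap (L := L) (IsCMField.complexConj L) hw) ϖ ((StdForm.antidiagonal 3).over (w.1.adicCompletion L))).dist ⟨stdLattice (w.1.adicCompletion L) 3, 0, isSelfDualLattice_stdLattice_three_of_v hϖ⟩ wtx = (latticeGraph (galAdicCompletionMap (L := L) (IsCMField.complexConj L) hw) ϖ ((StdForm.antidiagonal 3).over (w.1.adicCompletion L))).dist ⟨stdLattice (w.1.adicCompletion L) 3, 0, isSelfDualLattice_stdLattice_three_of_v hϖ⟩ cx + 1 ∧ latticeGraphIso (galAdicCompletionMap (L := L) (IsCMField.complexConj L) hw) ϖ ((StdForm.antidiagonal 3).over (w.1.adicCompletion L)) γ' wtx = wtx)} ∧ (¬ wtx.1.map ((Matrix.toLin' (((γ' : GL (Fin 3) (w.1.adicCompletion L)) : Matrix (Fin 3) (Fin 3) (w.1.adicCompletion L)) - 1)).restrictScalars (Valued.integer (w.1.adicCompletion L))) ≤ scaleLattice (ϖ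 ^ d₀) wtx.1 ∧ (wtx.1.map ((Matrix.toLin' (((γ' : GL (Fin 3) (w.1.adicCompletion L)) : Matrix (Fin 3) (Fin 3) (w.1.adicCompletion L)) - 1)).restrictScalars (Valued.integer (w.1.adicCompletion L))) ≤ scaleLattice (ϖ ^ (d₀ - 2)) wtx.1 ∧ ¬ wtx.1.map ((Matrix.toLin' (((γ' : GL (Fin 3) (w.1.adicCompletion L)) : Matrix (Fin 3) (Fin 3) (w.1.adicCompletion L)) - 1)).restrictScalars (Valued.integer (w.1.adicCompletion L))) ≤ scaleLattice (ϖ ^ (d₀ - 1)) wtx.1) ∧ ∃ y ∈ wtx.1, ∃ a : (w.1.adicCompletion L), Valued.v a = 1 ∧ Valued.v ((ϖ ^ (d₀ - 2))⁻¹ * pairing (galAdicCompletionMap (L := L) (IsCMField.complexConj L) hw) ((StdForm.antidiagonal 3).over (w.1.adicCompletion L)) y ((((γ' : GL (Fin 3) (w.1.adicCompletion L)) : Matrix (Fin 3) (Fin 3) (w.1.adicCompletion L)) - 1) *ᵥ y) - (c) * a ^ 2) < 1)}).ncard = q ^ 2)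
    (hPnQ : ∀ vtx ∈ {vtx : {M : Submodule (Valued.integer (w.1.adicCompletion L)) (Fin 3 → (w.1.adicCompletion L)) // IsVertex (galAdicCompletionMap (L := L) (IsCMField.complexConj L) hw) ϖ ((StdForm.antidiagonal 3).over (w.1.adicCompletion L)) M} | latticeGraphIso (galAdicCompletionMap (L := L) (IsCMField.complexConj L) hw) ϖ ((StdForm.antidiagonal 3).over (w.1.adicCompletion L)) γ' vtx = vtx ∧ IsSelfDualLattice (galAdicCompletionMap (L := L) (IsCMField.complexConj L) hw) ϖ ((StdForm.antidiagonal 3).over (w.1.adicCompletion L)) vtx.1 ∧ vtx.1.map ((Matrix.toLin' (((γ' : GL (Fin 3) (w.1.adicCompletion L)) : Matrix (Fin 3) (Fin 3) (w.1.adicCompletion L)) - 1)).restrictScalars (Valued.integer (w.1.adicCompletion L))) ≤ scaleLattice (ϖ ^ d₀) vtx.1}, ¬ Q vtx →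
      ({wtx | wtx ∈ {wtx | ∃ cx, ((latticeGraph (galAdicCompletionMap (L := L) (IsCMField.complexConj L) hw) ϖ ((StdForm.antidiagonal 3).over (w.1.adicCompletion L))).Adj vtx cx ∧ (latticeGraph (galAdicCompletionMap (L := L) (IsCMField.complexConj L) hw) ϖ ((StdForm.antidiagonal 3).over (w.1.adicCompletion L))).dist ⟨stdLattice (w.1.adicCompletion L) 3, 0, isSelfDualLattice_stdLattice_three_of_v hϖ⟩ cx = (latticeGraph (galAdicCompletionMap (L := L) (IsCMField.complexConj L) hw) ϖ ((StdForm.antidiagonal 3).over (w.1.adicCompletion L))).dist ⟨stdLattice (w.1.adicCompletion L) 3, 0, isSelfDualLattice_stdLattice_three_of_v hϖ⟩ vtx + 1 ∧ latticeGraphIso (galAdicCompletionMap (L := L) (IsCMField.complexConj L) hw) ϖ ((StdForm.antidiagonal 3).over (w.1.adicCompletion L)) γ' cx = cx) ∧ ((latticeGraph (galAdicCompletionMap (L := L) (IsCMField.complexConj L) hw) ϖ ((StdForm.antidiagonal 3).over (w.1.adicCompletion L))).Adj cx wtx ∧ (latticeGraph (galAdicCompletionMap (L := L) (IsCMField.complexConj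 L) hw) ϖ ((StdForm.antidiagonal 3).over (w.1.adicCompletion L))).dist ⟨stdLattice (w.1.adicCompletion L) 3, 0, isSelfDualLattice_stdLattice_three_of_v hϖ⟩ wtx = (latticeGraph (galAdicCompletionMap (L := L) (IsCMField.complexConj L) hw) ϖ ((StdForm.antidiagonal 3).over (w.1.adicCompletion L))).dist ⟨stdLattice (w.1.adicCompletion L) 3, 0, isSelfDualLattice_stdLattice_three_of_v hϖ⟩ cx + 1 ∧ latticeGraphIso (galAdicCompletionMap (L := L) (IsCMField.complexConj L) hw) ϖ ((StdForm.antidiagonal 3).over (w.1.adicCompletion L)) γ' wtx = wtx)} ∧ (¬ wtx.1.map ((Matrix.toLin' (((γ' : GL (Fin 3) (w.1.adicCompletion L)) : Matrix (Fin 3) (Fin 3) (w.1.adicCompletion L)) - 1)).restrictScalars (Valued.integer (w.1.adicCompletion L))) ≤ scaleLattice (ϖ ^ d₀) wtx.1 ∧ (wtx.1.map ((Matrix.toLin' (((γ' : GL (Fin 3) (w.1.adicCompletion L)) : Matrix (Fin 3) (Fin 3) (w.1.adicCompletion L)) - 1)).restrictScalars (Valued.integer (w.1.adicCompletion L))) ≤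 scaleLattice (ϖ ^ (d₀ - 2)) wtx.1 ∧ ¬ wtx.1.map ((Matrix.toLin' (((γ' : GL (Fin 3) (w.1.adicCompletion L)) : Matrix (Fin 3) (Fin 3) (w.1.adicCompletion L)) - 1)).restrictScalars (Valued.integer (w.1.adicCompletion L))) ≤ scaleLattice (ϖ ^ (d₀ - 1)) wtx.1) ∧ ∃ y ∈ wtx.1, ∃ a : (w.1.adicCompletion L), Valued.v a = 1 ∧ Valued.v ((ϖ ^ (d₀ - 2))⁻¹ * pairing (galAdicCompletionMap (L := L) (IsCMField.complexConj L) hw) ((StdForm.antidiagonal 3).over (w.1.adicCompletion L)) y ((((γ' : GL (Fin 3) (w.1.adicCompletion L)) : Matrix (Fin 3) (Fin 3) (w.1.adicCompletion L)) - 1) *ᵥ y) - (c) * a ^ 2) < 1)}).ncard = 0)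
    (hMQ : ∀ vtx ∈ {vtx : {M : Submodule (Valued.integer (w.1.adicCompletion L)) (Fin 3 → (w.1.adicCompletion L)) // IsVertex (galAdicCompletionMap (L := L) (IsCMField.complexConj L) hw) ϖ ((StdForm.antidiagonal 3).over (w.1.adicCompletion L)) M} | latticeGraphIso (galAdicCompletionMap (L := L) (IsCMField.complexConj L) hw) ϖ ((StdForm.antidiagonal 3).over (w.1.adicCompletion L)) γ' vtx = vtx ∧ IsSelfDualLattice (galAdicCompletionMap (L := L) (IsCMField.complexConj L) hw) ϖ ((StdForm.antidiagonal 3).over (w.1.adicCompletion L)) vtx.1 ∧ vtx.1.map ((Matrix.toLin' (((γ' : GL (Fin 3) (w.1.adicCompletion L)) : Matrix (Fin 3) (Fin 3) (w.1.adicCompletion L)) - 1)).restrictScalars (Valued.integer (w.1.adicCompletion L))) ≤ scaleLattice (ϖ ^ d₀) vtx.1}, Q vtx →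
      ({wtx | wtx ∈ {wtx | ∃ cx, ((latticeGraph (galAdicCompletionMap (L := L) (IsCMField.complexConj L) hw) ϖ ((StdForm.antidiagonal 3).over (w.1.adicCompletion L))).Adj vtx cx ∧ (latticeGraph (galAdicCompletionMap (L := L) (IsCMField.complexConj L) hw) ϖ ((StdForm.antidiagonal 3).over (w.1.adicCompletion L))).dist ⟨stdLattice (w.1.adicCompletion L) 3, 0, isSelfDualLattice_stdLattice_three_of_v hϖ⟩ cx = (latticeGraph (galAdicCompletionMap (L := L) (IsCMField.complexConj L) hw) ϖ ((StdForm.antidiagonal 3).over (w.1.adicCompletion L))).dist ⟨stdLattice (w.1.adicCompletion L) 3, 0, isSelfDualLattice_stdLattice_three_of_v hϖ⟩ vtx + 1 ∧ latticeGraphIso (galAdicCompletionMap (L := L) (IsCMField.complexConj L) hw) ϖ ((StdForm.antidiagonal 3).over (w.1.adicCompletion L)) γ' cx = cx) ∧ ((latticeGraph (galAdicCompletionMap (L := L) (IsCMField.complexConj L) hw) ϖ ((StdForm.antidiagonal 3).over (w.1.adicCompletion L))).Adj cx wtx ∧ (latticeGraph (galAdicCompletionMap (L := L) (IsCMField.complexConj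 L) hw) ϖ ((StdForm.antidiagonal 3).over (w.1.adicCompletion L))).dist ⟨stdLattice (w.1.adicCompletion L) 3, 0, isSelfDualLattice_stdLattice_three_of_v hϖ⟩ wtx = (latticeGraph (galAdicCompletionMap (L := L) (IsCMField.complexConj L) hw) ϖ ((StdForm.antidiagonal 3).over (w.1.adicCompletion L))).dist ⟨stdLattice (w.1.adicCompletion L) 3, 0, isSelfDualLattice_stdLattice_three_of_v hϖ⟩ cx + 1 ∧ latticeGraphIso (galAdicCompletionMap (L := L) (IsCMField.complexConj L) hw) ϖ ((StdForm.antidiagonal 3).over (w.1.adicCompletion L)) γ' wtx = wtx)} ∧ (¬ wtx.1.map ((Matrix.toLin' (((γ' : GL (Fin 3) (w.1.adicCompletion L)) : Matrix (Fin 3) (Fin 3) (w.1.adicCompletion L)) - 1)).restrictScalars (Valued.integer (w.1.adicCompletion L))) ≤ scaleLattice (ϖ ^ d₀) wtx.1 ∧ (wtx.1.map ((Matrix.toLin' (((γ' : GL (Fin 3) (w.1.adicCompletion L)) : Matrix (Fin 3) (Fin 3) (w.1.adicCompletion L)) - 1)).restrictScalars (Valued.integer (w.1.adicCompletion L))) ≤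 scaleLattice (ϖ ^ (d₀ - 2)) wtx.1 ∧ ¬ wtx.1.map ((Matrix.toLin' (((γ' : GL (Fin 3) (w.1.adicCompletion L)) : Matrix (Fin 3) (Fin 3) (w.1.adicCompletion L)) - 1)).restrictScalars (Valued.integer (w.1.adicCompletion L))) ≤ scaleLattice (ϖ ^ (d₀ - 1)) wtx.1) ∧ ¬ (∃ y ∈ wtx.1, ∃ a : (w.1.adicCompletion L), Valued.v a = 1 ∧ Valued.v ((ϖ ^ (d₀ - 2))⁻¹ * pairing (galAdicCompletionMap (L := L) (IsCMField.complexConj L) hw) ((StdForm.antidiagonal 3).over (w.1.adicCompletion L)) y ((((γ' : GL (Fin 3) (w.1.adicCompletion L)) : Matrix (Fin 3) (Fin 3) (w.1.adicCompletion L)) - 1) *ᵥ y) - (c) * a ^ 2) < 1))}).ncard = 0)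
    (hMnQ : ∀ vtx ∈ {vtx : {M : Submodule (Valued.integer (w.1.adicCompletion L)) (Fin 3 → (w.1.adicCompletion L)) // IsVertex (galAdicCompletionMap (L := L) (IsCMField.complexConj L) hw) ϖ ((StdForm.antidiagonal 3).over (w.1.adicCompletion L)) M} | latticeGraphIso (galAdicCompletionMap (L := L) (IsCMField.complexConj L) hw) ϖ ((StdForm.antidiagonal 3).over (w.1.adicCompletion L)) γ' vtx = vtx ∧ IsSelfDualLattice (galAdicCompletionMap (L := L) (IsCMField.complexConj L) hw) ϖ ((StdForm.antidiagonal 3).over (w.1.adicCompletion L)) vtx.1 ∧ vtx.1.map ((Matrix.toLin' (((γ' : GL (Fin 3) (w.1.adicCompletion L)) : Matrix (Fin 3) (Fin 3) (w.1.adicCompletion L)) - 1)).restrictScalars (Valued.integer (w.1.adicCompletion L))) ≤ scaleLattice (ϖ ^ d₀) vtx.1}, ¬ Q vtx →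
      ({wtx | wtx ∈ {wtx | ∃ cx, ((latticeGraph (galAdicCompletionMap (L := L) (IsCMField.complexConj L) hw) ϖ ((StdForm.antidiagonal 3).over (w.1.adicCompletion L))).Adj vtx cx ∧ (latticeGraph (galAdicCompletionMap (L := L) (IsCMField.complexConj L) hw) ϖ ((StdForm.antidiagonal 3).over (w.1.adicCompletion L))).dist ⟨stdLattice (w.1.adicCompletion L) 3, 0, isSelfDualLattice_stdLattice_three_of_v hϖ⟩ cx = (latticeGraph (galAdicCompletionMap (L := L) (IsCMField.complexConj L) hw) ϖ ((StdForm.antidiagonal 3).over (w.1.adicCompletion L))).dist ⟨stdLattice (w.1.adicCompletion L) 3, 0, isSelfDualLattice_stdLattice_three_of_v hϖ⟩ vtx + 1 ∧ latticeGraphIso (galAdicCompletionMap (L := L) (IsCMField.complexConj L) hw) ϖ ((StdForm.antidiagonal 3).over (w.1.adicCompletion L)) γ' cx = cx) ∧ ((latticeGraph (galAdicCompletionMap (L := L) (IsCMField.complexConj L) hw) ϖ ((StdForm.antidiagonal 3).over (w.1.adicCompletion L))).Adj cx wtx ∧ (latticeGraph (galAdicCompletionMap (L := L) (IsCMField.complexConj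 L) hw) ϖ ((StdForm.antidiagonal 3).over (w.1.adicCompletion L))).dist ⟨stdLattice (w.1.adicCompletion L) 3, 0, isSelfDualLattice_stdLattice_three_of_v hϖ⟩ wtx = (latticeGraph (galAdicCompletionMap (L := L) (IsCMField.complexConj L) hw) ϖ ((StdForm.antidiagonal 3).over (w.1.adicCompletion L))).dist ⟨stdLattice (w.1.adicCompletion L) 3, 0, isSelfDualLattice_stdLattice_three_of_v hϖ⟩ cx + 1 ∧ latticeGraphIso (galAdicCompletionMap (L := L) (IsCMField.complexConj L) hw) ϖ ((StdForm.antidiagonal 3).over (w.1.adicCompletion L)) γ' wtx = wtx)} ∧ (¬ wtx.1.map ((Matrix.toLin' (((γ' : GL (Fin 3) (w.1.adicCompletion L)) : Matrix (Fin 3) (Fin 3) (w.1.adicCompletion L)) - 1)).restrictScalars (Valued.integer (w.1.adicCompletion L))) ≤ scaleLattice (ϖ ^ d₀) wtx.1 ∧ (wtx.1.map ((Matrix.toLin' (((γ' : GL (Fin 3) (w.1.adicCompletion L)) : Matrix (Fin 3) (Fin 3) (w.1.adicCompletion L)) - 1)).restrictScalars (Valued.integer (w.1.adicCompletion L))) ≤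 scaleLattice (ϖ ^ (d₀ - 2)) wtx.1 ∧ ¬ wtx.1.map ((Matrix.toLin' (((γ' : GL (Fin 3) (w.1.adicCompletion L)) : Matrix (Fin 3) (Fin 3) (w.1.adicCompletion L)) - 1)).restrictScalars (Valued.integer (w.1.adicCompletion L))) ≤ scaleLattice (ϖ ^ (d₀ - 1)) wtx.1) ∧ ¬ (∃ y ∈ wtx.1, ∃ a : (w.1.adicCompletion L), Valued.v a = 1 ∧ Valued.v ((ϖ ^ (d₀ - 2))⁻¹ * pairing (galAdicCompletionMap (L := L) (IsCMField.complexConj L) hw) ((StdForm.antidiagonal 3).over (w.1.adicCompletion L)) y ((((γ' : GL (Fin 3) (w.1.adicCompletion L)) : Matrix (Fin 3) (Fin 3) (w.1.adicCompletion L)) - 1) *ᵥ y) - (c) * a ^ 2) < 1))}).ncard = q ^ 2)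
    (mA : ℕ) (hnA : n = mA + 1) (hmN : m = 2 * n) :
    ({M : Submodule (Valued.integer (w.1.adicCompletion L)) (Fin 3 → (w.1.adicCompletion L)) | IsSelfDualLattice (galAdicCompletionMap (L := L) (IsCMField.complexConj L) hw) ϖ (placeForm (Matrix.of fun i j : Fin 3 => if i.val + j.val + 1 = 3 then (1 : L) else 0) w.1) M ∧ mapGL (endoGL (((localNonsplitEquiv (IsCMField.complexConj L) (Matrix.of fun i j : Fin 2 => if i.val + j.val + 1 = 2 then (1 : L) else 0) (IsCMField.complexConj_ne_one L) w hw γH.1).val : GL (Fin 2) (w.1.adicCompletion L)), ((localNonsplitEquiv (IsCMField.complexConj L) (Matrix.of fun i j : Fin 1 => if i.val + j.val + 1 = 1 then (1 : L) else 0) (IsCMField.complexConj_ne_one L) w hw γH.2).val : GL (Fin 1) (w.1.adicCompletion L)))) M = M ∧ (M.map ((Matrix.toLin' (((endoGL (((localNonsplitEquiv (IsCMField.complexConj L) (Matrix.of fun i j : Fin 2 => if i.val + j.val + 1 = 2 then (1 : L) else 0) (IsCMField.complexConj_ne_one L) w hw γH.1).val : GL (Fin 2) (w.1.adicCompletion L)),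 ((localNonsplitEquiv (IsCMField.complexConj L) (Matrix.of fun i j : Fin 1 => if i.val + j.val + 1 = 1 then (1 : L) else 0) (IsCMField.complexConj_ne_one L) w hw γH.2).val : GL (Fin 1) (w.1.adicCompletion L))) : GL (Fin 3) (w.1.adicCompletion L)) : Matrix (Fin 3) (Fin 3) (w.1.adicCompletion L)) - 1)).restrictScalars (Valued.integer (w.1.adicCompletion L))) ≤ scaleLattice ϖ M ∧ ¬ M.map ((Matrix.toLin' (((endoGL (((localNonsplitEquiv (IsCMField.complexConj L) (Matrix.of fun i j : Fin 2 => if i.val + j.val + 1 = 2 then (1 : L) else 0) (IsCMField.complexConj_ne_one L) w hw γH.1).val : GL (Fin 2) (w.1.adicCompletion L)), ((localNonsplitEquiv (IsCMField.complexConj L) (Matrix.of fun i j : Fin 1 => if i.val + j.val + 1 = 1 then (1 : L) else 0) (IsCMField.complexConj_ne_one L) w hw γH.2).val : GL (Fin 1) (w.1.adicCompletion L))) : GL (Fin 3) (w.1.adicCompletion L)) : Matrix (Fin 3) (Fin 3) (w.1.adicCompletion L)) - 1)).restrictScalars (Valued.integer (w.1.adicCompletion L))) ≤ scaleLattice (ϖ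 ^ 2) M ∧ M.map ((Matrix.toLin' ((((endoGL (((localNonsplitEquiv (IsCMField.complexConj L) (Matrix.of fun i j : Fin 2 => if i.val + j.val + 1 = 2 then (1 : L) else 0) (IsCMField.complexConj_ne_one L) w hw γH.1).val : GL (Fin 2) (w.1.adicCompletion L)), ((localNonsplitEquiv (IsCMField.complexConj L) (Matrix.of fun i j : Fin 1 => if i.val + j.val + 1 = 1 then (1 : L) else 0) (IsCMField.complexConj_ne_one L) w hw γH.2).val : GL (Fin 1) (w.1.adicCompletion L))) : GL (Fin 3) (w.1.adicCompletion L)) : Matrix (Fin 3) (Fin 3) (w.1.adicCompletion L)) - 1) ^ 2)).restrictScalars (Valued.integer (w.1.adicCompletion L))) ≤ scaleLattice (ϖ ^ 3) M ∧ ∃ y ∈ M, ∃ a : (w.1.adicCompletion L), Valued.v a = 1 ∧ Valued.v (ϖ⁻¹ * pairing (galAdicCompletionMap (L := L) (IsCMField.complexConj L) hw) (placeForm (Matrix.of fun i j : Fin 3 => if i.val + j.val + 1 = 3 then (1 : L) else 0) w.1) y ((((endoGL (((localNonsplitEquiv (IsCMField.complexConj L) (Matrix.of fun i j : Fin 2 =>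 if i.val + j.val + 1 = 2 then (1 : L) else 0) (IsCMField.complexConj_ne_one L) w hw γH.1).val : GL (Fin 2) (w.1.adicCompletion L)), ((localNonsplitEquiv (IsCMField.complexConj L) (Matrix.of fun i j : Fin 1 => if i.val + j.val + 1 = 1 then (1 : L) else 0) (IsCMField.complexConj_ne_one L) w hw γH.2).val : GL (Fin 1) (w.1.adicCompletion L))) : GL (Fin 3) (w.1.adicCompletion L)) : Matrix (Fin 3) (Fin 3) (w.1.adicCompletion L)) - 1) *ᵥ y) - c * a ^ 2) < 1)}.ncard : ℂ) =
      ((Ideal.absNorm v.asIdeal : ℂ) + 1) / 2 * (Ideal.absNorm v.asIdeal : ℂ) ^ (2 * mA) ∧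
    ({M : Submodule (Valued.integer (w.1.adicCompletion L)) (Fin 3 → (w.1.adicCompletion L)) | IsSelfDualLattice (galAdicCompletionMap (L := L) (IsCMField.complexConj L) hw) ϖ (placeForm (Matrix.of fun i j : Fin 3 => if i.val + j.val + 1 = 3 then (1 : L) else 0) w.1) M ∧ mapGL (endoGL (((localNonsplitEquiv (IsCMField.complexConj L) (Matrix.of fun i j : Fin 2 => if i.val + j.val + 1 = 2 then (1 : L) else 0) (IsCMField.complexConj_ne_one L) w hw γH.1).val : GL (Fin 2) (w.1.adicCompletion L)), ((localNonsplitEquiv (IsCMField.complexConj L) (Matrix.of fun i j : Fin 1 => if i.val + j.val + 1 = 1 then (1 : L) else 0) (IsCMField.complexConj_ne_one L) w hw γH.2).val : GL (Fin 1) (w.1.adicCompletion L)))) M = M ∧ (M.map ((Matrix.toLin' (((endoGL (((localNonsplitEquiv (IsCMField.complexConj L) (Matrix.of fun i j : Fin 2 => if i.val + j.val + 1 = 2 then (1 : L) else 0) (IsCMField.complexConj_ne_one L) w hw γH.1).val : GL (Fin 2) (w.1.adicCompletion L)), ((localNonsplitEquiv (IsCMField.complexConj L) (Matrix.of fun i j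 : Fin 1 => if i.val + j.val + 1 = 1 then (1 : L) else 0) (IsCMField.complexConj_ne_one L) w hw γH.2).val : GL (Fin 1) (w.1.adicCompletion L))) : GL (Fin 3) (w.1.adicCompletion L)) : Matrix (Fin 3) (Fin 3) (w.1.adicCompletion L)) - 1)).restrictScalars (Valued.integer (w.1.adicCompletion L))) ≤ scaleLattice ϖ M ∧ ¬ M.map ((Matrix.toLin' (((endoGL (((localNonsplitEquiv (IsCMField.complexConj L) (Matrix.of fun i j : Fin 2 => if i.val + j.val + 1 = 2 then (1 : L) else 0) (IsCMField.complexConj_ne_one L) w hw γH.1).val : GL (Fin 2) (w.1.adicCompletion L)), ((localNonsplitEquiv (IsCMField.complexConj L) (Matrix.of fun i j : Fin 1 => if i.val + j.val + 1 = 1 then (1 : L) else 0) (IsCMField.complexConj_ne_one L) w hw γH.2).val : GL (Fin 1) (w.1.adicCompletion L))) : GL (Fin 3) (w.1.adicCompletion L)) : Matrix (Fin 3) (Fin 3) (w.1.adicCompletion L)) - 1)).restrictScalars (Valued.integer (w.1.adicCompletion L))) ≤ scaleLattice (ϖ ^ 2) M ∧ M.map ((Matrix.toLin' ((((endoGL (((localNonsplitEquiv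 (IsCMField.complexConj L) (Matrix.of fun i j : Fin 2 => if i.val + j.val + 1 = 2 then (1 : L) else 0) (IsCMField.complexConj_ne_one L) w hw γH.1).val : GL (Fin 2) (w.1.adicCompletion L)), ((localNonsplitEquiv (IsCMField.complexConj L) (Matrix.of fun i j : Fin 1 => if i.val + j.val + 1 = 1 then (1 : L) else 0) (IsCMField.complexConj_ne_one L) w hw γH.2).val : GL (Fin 1) (w.1.adicCompletion L))) : GL (Fin 3) (w.1.adicCompletion L)) : Matrix (Fin 3) (Fin 3) (w.1.adicCompletion L)) - 1) ^ 2)).restrictScalars (Valued.integer (w.1.adicCompletion L))) ≤ scaleLattice (ϖ ^ 3) M ∧ ¬ ∃ y ∈ M, ∃ a : (w.1.adicCompletion L), Valued.v a = 1 ∧ Valued.v (ϖ⁻¹ * pairing (galAdicCompletionMap (L := L) (IsCMField.complexConj L) hw) (placeForm (Matrix.of fun i j : Fin 3 => if i.val + j.val + 1 = 3 then (1 : L) else 0) w.1) y ((((endoGL (((localNonsplitEquiv (IsCMField.complexConj L) (Matrix.of fun i j : Fin 2 => if i.val + j.val + 1 = 2 then (1 : L) else 0) (IsCMField.complexConj_ne_one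 L) w hw γH.1).val : GL (Fin 2) (w.1.adicCompletion L)), ((localNonsplitEquiv (IsCMField.complexConj L) (Matrix.of fun i j : Fin 1 => if i.val + j.val + 1 = 1 then (1 : L) else 0) (IsCMField.complexConj_ne_one L) w hw γH.2).val : GL (Fin 1) (w.1.adicCompletion L))) : GL (Fin 3) (w.1.adicCompletion L)) : Matrix (Fin 3) (Fin 3) (w.1.adicCompletion L)) - 1) *ᵥ y) - c * a ^ 2) < 1)}.ncard : ℂ) =
      ((Ideal.absNorm v.asIdeal : ℂ) + 1) / 2 * (Ideal.absNorm v.asIdeal : ℂ) ^ (2 * mA) := by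
  classical
  have hn2 : 2 ≤ n := typeTwo_two_le_n_of_even_ram L w hw he h2 ϖ hϖ hσϖ hblk hirr hdisc hn
  obtain ⟨mA', rfl⟩ : ∃ mA' : ℕ, mA = mA' + 1 := ⟨mA - 1, by omega⟩
  obtain rfl : d₀ = 2 * n - 1 := by omega
  -- `#R = q + 1` (★ p849413), so `R` is finite; the kind halves
  have hR := ncard_rootRegion_hyperbolic_of_even_A_ram L w hw he h2 ϖ hϖ hσϖ γH hblk hu2 hirr hdisc hn m hm β hβ s hs k hk γ' hγ' hmN
  have hRfin := Set.finite_of_ncard_ne_zero (ne_of_eq_of_ne hR (Nat.succ_ne_zero _))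
  rw [ncard_setOf_mem_and_eq_card_filter hRfin] at hQ
  have hRN : hRfin.toFinset.card = Nat.card (𝓞 ↥(maximalRealSubfield L) ⧸ v.asIdeal) + 1 := by rw [← Set.ncard_eq_toFinset_card _ hRfin, hR]
  have hsplit := Finset.card_filter_add_card_filter_not (s := hRfin.toFinset) (fun vtx => Q vtx)
  rw [hRN] at hsplit
  have hQ' : 2 * (hRfin.toFinset.filter fun vtx => ¬ Q vtx).card = Nat.card (𝓞 ↥(maximalRealSubfield L) ⧸ v.asIdeal) + 1 := by omega
  -- the kind-keyed pooled atoms `NP = NM = #{Q} · q² = #{¬Q} · q²` (in `ℕ`)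
  have hNP := sum_eq_card_filter_mul_add hRfin.toFinset (fun vtx => Q vtx) (q ^ 2) 0
    (fun vtx hv hQv => hPQ vtx (hRfin.mem_toFinset.1 hv) hQv) (fun vtx hv hQv => hPnQ vtx (hRfin.mem_toFinset.1 hv) hQv)
  have hNM := sum_eq_card_filter_mul_add hRfin.toFinset (fun vtx => Q vtx) 0 (q ^ 2)
    (fun vtx hv hQv => hMQ vtx (hRfin.mem_toFinset.1 hv) hQv) (fun vtx hv hQv => hMnQ vtx (hRfin.mem_toFinset.1 hv) hQv)
  rw [mul_zero, add_zero] at hNP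
  rw [mul_zero, zero_add] at hNM
  -- casts (no `rw` of `Nat.cast` patterns next to the pooled sums)
  have hq' : ((Nat.card (𝓞 ↥(maximalRealSubfield L) ⧸ v.asIdeal) : ℕ) : ℂ) = (Ideal.absNorm v.asIdeal : ℂ) := by
    rw [Ideal.absNorm_apply, Submodule.cardQuot_apply]
  have hnQ : (((hRfin.toFinset.filter fun vtx => Q vtx).card : ℕ) : ℂ) = ((Ideal.absNorm v.asIdeal : ℂ) + 1) / 2 := by
    rw [eq_div_iff (two_ne_zero' ℂ), mul_comm, ← hq']; exact_mod_cast hQ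
  have hnQ' : (((hRfin.toFinset.filter fun vtx => ¬ Q vtx).card : ℕ) : ℂ) = ((Ideal.absNorm v.asIdeal : ℂ) + 1) / 2 := by
    rw [eq_div_iff (two_ne_zero' ℂ), mul_comm, ← hq']; exact_mod_cast hQ'
  have hNPc := congrArg (Nat.cast : ℕ → ℂ) hNP
  have hNMc := congrArg (Nat.cast : ℕ → ℂ) hNM
  simp only [Nat.cast_mul, Nat.cast_pow, hnQ, hq] at hNPc
  simp only [Nat.cast_mul, Nat.cast_pow, hnQ', hq] at hNMc
  -- ★ pm head at root depth `2n − 1 = 2mA' + 3`, `sR := R`, `NE := 0`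
  obtain ⟨kP, kM⟩ := hyperbolicTotal_pm_ram_of_region_census_odd L w hw he h2 ϖ hϖ hσϖ γH hu2 hirr (2 * n - 1) mA' (by omega) s hs k hk hd γ' hγ' c ε hc hεv hε
    hRfin.toFinset (fun vtx => hRfin.mem_toFinset) 0 _ _ (Finset.sum_eq_zero fun vtx hv => hE0 vtx (hRfin.mem_toFinset.1 hv)) rfl rfl
  simp only [hNPc, hNMc, ite_self, Nat.cast_zero, zero_mul, zero_add] at kP kM
  exact ⟨kP.trans (by ring), kM.trans (by ring)⟩

end Literature.NumberTheory.Rogawski1990.BlockLawHyp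

end
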